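import Summits.NavierStokesRegularity.NavierStokesRegularity.Theses.AxisymmetricExtremality
import Summits.NavierStokesRegularity.NavierStokesRegularity.Theorems.AxisymmetricExtremalityAxisymmetricKatoGlobalStubKatoAxisymSingularPoint
import Summits.NavierStokesRegularity.NavierStokesRegularity.Theorems.AxisymmetricExtremalityAxisymmetricKatoGlobalStubKatoLocalEnergyNearTop
import Summits.NavierStokesRegularity.NavierStokesRegularity.Theorems.AxisymmetricExtremalityAxisymmetricKatoGlobalStubOffAxisBoundedOfLocalEnergy
import Summits.NavierStokesRegularity.NavierStokesRegularity.Theorems.AxisymmetricExtremalityAxisymmetricKatoGlobalReduction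
import Summits.NavierStokesRegularity.NavierStokesRegularity.Theorems.AxisymmetricExtremalityAxisymmetricKatoGlobalNoSwirlStratum
import Literature.Analysis.FluidPDE.KatoLocalLerayPressure
import Literature.Analysis.FluidPDE.KatoL3Uniqueness
import Literature.Analysis.FluidPDE.KatoMaximalTime
import Literature.Analysis.FluidPDE.SereginSverakBlowupSelection
import Literature.Analysis.FluidPDE.AxisymmetricTypeIBounded
import Literature.Analysis.FluidPDE.Seregin2022LogSwirlOriginHolds
import Summits.NavierStokesRegularity.NavierStokesRegularity.Theorems.AxisymmetricExtremalityAxisymmetricKatoGlobalSwirlAxisModulusBelow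
import HarnessLib

/-!
# Strategist census s20-g7 (family `s`, independent) — crux `AxisymmetricExtremality.AxisymmetricKatoGlobal`
# (stmt-NavierStokesRegularity-15453): kernel-checked companion of `STRATEGY-CENSUS-s20-g7.md`

Nothing here is a registered line and nothing is sorried.  The file certifies, against the tree as
it stands (route file rev 3 + the landed stubs of line `registered`), the three structural facts the
census rests on:

* §1 `NoAxisymMinimalDatum` (W0) is the WEAKEST statement the route's deciding theorem accepts in
  place of the crux (`closes_of_noAxisymMinimalDatum`, same proof as `closes`), it is implied by the
  crux (`noAxisymMinimalDatum_of_crux`), and its swirl-free stratum is already a theorem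
  (`noAxisymMinimalDatum_noSwirl`, from the landed no-swirl stratum) — so the residual content of
  W0 is exactly "axisymmetric WITH swirl at the Rusin–Šverák threshold".
* §2 The crux is EQUIVALENT, over landed theorems only, to final-time regularity of the axis for
  axisymmetric Kato solutions (`KatoAxisRegularTop`): `crux_of_katoAxisRegularTop` (forward: landed
  stubs 1, K, 2b' of line `registered`) and `katoAxisRegularTop_of_crux` (converse: Kato smoothing
  `IsKatoSolutionOn.exists_ae_norm_le_of_pos`, uniqueness `kato_unique_holds`, continuity).  Hence in
  ANY split "printed local criterion K + a-priori estimate E at the axis up to T_max", the estimate E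
  is sandwiched `bounded ⇒ E ⇒[K] bounded`, i.e. `E ≡ crux` modulo K.
* §2b The LIVE line's open stub is the crux modulo the tree: `SwirlAxisModulusAx` (= hypothesis 2 of
  `Registered.AxisymmetricKatoGlobal_of_logSwirlFacts` + `IsAxisymmetric u₀`) satisfies
  `crux_iff_swirlAxisModulusAx`, using the DISCHARGED Seregin 2022 criterion
  (`Literature.Analysis.FluidPDE.seregin2022_logSwirl_regularAtOrigin_holds`) forward and
  `forall_norm_le_of_crux` + `|Γ| ≤ 2 r ‖u‖` backward.
* §3 The swirl-size split (Dec-D) is a genuine two-piece case split with proved assembly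
  (`crux_of_swirlSplit`); its small piece `AKGSmallSwirl ε` is implied by the crux and is itself
  the open "absolute small-swirl" problem (Lei–Ren 2022, after Thm 3), its large piece is the crux on
  generic data.
-/

noncomputable section

-- the summit and its single problem share the name (D-0017 nested layout)
set_option linter.dupNamespace false

open Set MeasureTheory Filter Topology Function Metric
open scoped ENNReal NNReal
open Literature.Analysis.FluidPDE Literature.Analysis.FunctionSpaces

namespace Summit.NavierStokesRegularity.NavierStokesRegularity.Cruxes.AxisymmetricKatoGlobal.StrategistS20g7

open Summit.NavierStokesRegularity.NavierStokesRegularity.Theses.AxisymmetricExtremality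
open Summit.NavierStokesRegularity.NavierStokesRegularity.Theorems.AxisymmetricKatoGlobal

local notation "ℝ³" => EuclideanSpace ℝ (Fin 3)
local notation "ℂ³" => EuclideanSpace ℂ (Fin 3)

/-! ## §1 The weakest intermediate the deciding theorem accepts -/

/-- **W0 — no axisymmetric minimal blow-up datum.**  `closes` consumes the crux only at an
axisymmetric `IsMinimalBlowupDatum`; this is the literal residue. -/
def NoAxisymMinimalDatum : Prop :=
  ∀ ν : ℝ, 0 < ν → ∀ (u₀ : ℝ³ → ℝ³) (g : HomSobolev ℝ³ ℂ³ (1 / 2 : ℝ)),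
    IsMinimalBlowupDatum ν u₀ g → IsAxisymmetric u₀ → False

/-- The crux implies W0 (the minimality clause `¬ HasGlobalKatoSolution` is contradicted). -/
theorem noAxisymMinimalDatum_of_crux (h : AxisymmetricKatoGlobal) : NoAxisymMinimalDatum := by
  intro ν hν u₀ g hmin hax
  obtain ⟨hL3, hrep, hdiv, -, hnot⟩ := hmin
  exact hnot (h ν hν u₀ g hL3 hrep hdiv (fun θ x => hax θ x))

/-- **`closes` with W0 in place of the crux** — verbatim the route's deciding argument, so W0 is an
admissible (and the weakest) replacement of `AxisymmetricKatoGlobal` in the route. -/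
theorem closes_of_noAxisymMinimalDatum (h₂ : MinimalDatumPFold) (h₄ : PFoldToAxisymmetric)
    (h₃ : NoAxisymMinimalDatum) : NavierStokesRegularity := by
  show Literature.NS.NavierStokesExistenceSmoothR3
  intro ν hν u₀ hsm hdiv hdec
  by_contra hno
  obtain ⟨u₁, g, hmin, hax⟩ := h₄ ν hν (h₂ ν hν ⟨u₀, hsm, hdiv, hdec, hno⟩)
  exact h₃ ν hν u₁ g hmin (fun θ x => hax θ x)

/-- **The swirl-free stratum of W0 is settled** (landed:
`NoSwirlStratum.hasGlobalKatoSolution_of_isAxisymmetric_hasNoSwirl_viscosity`): an axisymmetric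
minimal blow-up datum necessarily HAS swirl. -/
theorem noAxisymMinimalDatum_noSwirl :
    ∀ ν : ℝ, 0 < ν → ∀ (u₀ : ℝ³ → ℝ³) (g : HomSobolev ℝ³ ℂ³ (1 / 2 : ℝ)),
      IsMinimalBlowupDatum ν u₀ g → IsAxisymmetric u₀ → HasNoSwirl u₀ → False := by
  intro ν hν u₀ g hmin hax hsw
  obtain ⟨hL3, -, hdiv, -, hnot⟩ := hmin
  exact hnot
    (NoSwirlStratum.hasGlobalKatoSolution_of_isAxisymmetric_hasNoSwirl_viscosity hν hL3 hdiv hax hsw)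

/-! ## §2 The crux IS final-time axis regularity of axisymmetric Kato solutions -/

/-- **E\* — axis regularity at the top.**  For an axisymmetric Kato solution `u` on `[0, T)` (datum
`u₀ ∈ L³` axisymmetric with an `Ḣ^{1/2}` representative `g`), smooth with axisymmetric slices on
the open strip, every point of the axis is bounded near `(T, ·)`. -/
def KatoAxisRegularTop : Prop :=
  ∀ ν : ℝ, 0 < ν → ∀ T : ℝ, 0 < T → ∀ (u₀ : ℝ³ → ℝ³) (g : HomSobolev ℝ³ ℂ³ (1 / 2 : ℝ))
    (u : ℝ → ℝ³ → ℝ³),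
    g.Represents (Literature.Analysis.FunctionSpaces.EuclideanSpace.complexify ∘ u₀) →
    IsAxisymmetric u₀ → IsKatoSolutionOn T ν u₀ u →
    ContDiffOn ℝ (⊤ : ℕ∞) (uncurry u) (Ioo 0 T ×ˢ univ) → (∀ t ∈ Ioo 0 T, IsAxisymmetric (u t)) →
    ∀ x₀ : ℝ³, cylRadius x₀ = 0 → IsBoundedNearTop u T x₀

/-- **Forward: E\* ⇒ crux**, over LANDED theorems only (line `registered`: stub 1
`stub_katoAxisymSingularPoint`, stub K `stub_katoLocalEnergyNearTop`, stub 2b'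
`stub_offAxisBounded_of_localEnergy`).  By contradiction: a singular point `(T, x_*)` of the
maximal Kato solution; off the axis it is bounded by rotation packing + ε-regularity, on the axis
by E\*; either way the `L^∞` norm on a backward cylinder is finite. -/
theorem crux_of_katoAxisRegularTop (hE : KatoAxisRegularTop) : AxisymmetricKatoGlobal := by
  intro ν hν u₀ g hL3 hrep hdiv hax
  have hax' : IsAxisymmetric u₀ := fun θ x => hax θ x
  by_contra hng
  obtain ⟨T, hT, xs, u, hK, hsm, haxi, hsing⟩ :=
    Registered.stub_katoAxisymSingularPoint ν hν u₀ hL3 hdiv hax' hng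
  have hbd : IsBoundedNearTop u T xs := by
    by_cases h0 : cylRadius xs = 0
    · exact hE ν hν T hT u₀ g u hrep hax' hK hsm haxi xs h0
    · obtain ⟨p, -, hsw, hloc⟩ := Registered.stub_katoLocalEnergyNearTop ν hν T hT u₀ u hK hsm haxi
      exact Registered.stub_offAxisBounded_of_localEnergy ν hν T hT u p hsm haxi hsw hloc xs h0
  obtain ⟨r, hr, K, hbd'⟩ := hbd
  exact absurd (hsing r hr) (Registered.eLpNorm_parabolicCylinder_lt_top_of_forall_le hbd').ne

/-- **Under the crux, a Kato solution is bounded everywhere on every `(a, T) × ℝ³`, `0 < a`.**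
The crux gives a global Kato solution `v`; Kato smoothing bounds `v` essentially on
`(a, T) × ℝ³`; uniqueness in the Kato class identifies `u(t)` with `v(t)` a.e. for `t < T`;
continuity of `u` on the open strip upgrades the essential bound to an everywhere bound. -/
theorem forall_norm_le_of_crux (h : AxisymmetricKatoGlobal) {ν T : ℝ} (hν : 0 < ν) (hT : 0 < T)
    {u₀ : ℝ³ → ℝ³} {g : HomSobolev ℝ³ ℂ³ (1 / 2 : ℝ)} {u : ℝ → ℝ³ → ℝ³}
    (hrep : g.Represents (Literature.Analysis.FunctionSpaces.EuclideanSpace.complexify ∘ u₀))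
    (hax : IsAxisymmetric u₀) (hK : IsKatoSolutionOn T ν u₀ u)
    (hsm : ContDiffOn ℝ (⊤ : ℕ∞) (uncurry u) (Ioo 0 T ×ˢ univ)) {a : ℝ} (ha : 0 < a) :
    ∃ M : ℝ, ∀ t ∈ Ioo a T, ∀ x, ‖u t x‖ ≤ M := by
  -- the global Kato solution, restricted to `[0, T + 1)`
  have hglob : HasGlobalKatoSolution ν u₀ :=
    h ν hν u₀ g (hK.memLp_initial hT) hrep (hK.isWeaklyDivFree_initial hT) (fun θ x => hax θ x)
  obtain ⟨v, hv⟩ := hglob.exists_isKatoSolutionOn (T + 1)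
  -- Kato smoothing: `v` is essentially bounded on `(a, T) × ℝ³`
  obtain ⟨M, hM⟩ := hv.exists_ae_norm_le_of_pos hν ha (show T < T + 1 by linarith)
  refine ⟨M, ?_⟩
  -- slice form: for a.e. `t ∈ (a, T)`, `‖v t x‖ ≤ M` for a.e. `x`
  have hM' : ∀ᵐ t ∂(volume.restrict (Ioo a T)), ∀ᵐ x ∂(volume : Measure ℝ³), ‖v t x‖ ≤ M := by
    have hprod : (volume : Measure (ℝ × ℝ³)).restrict (Ioo a T ×ˢ (univ : Set ℝ³)) =
        ((volume : Measure ℝ).restrict (Ioo a T)).prod ((volume : Measure ℝ³).restrict univ) := by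
      rw [Measure.prod_restrict, ← Measure.volume_eq_prod]
    rw [hprod] at hM
    have h2 := Measure.ae_ae_of_ae_prod hM
    simpa only [Measure.restrict_univ] using h2
  have hcont : ContinuousOn (uncurry u) (Ioo 0 T ×ˢ univ) := hsm.continuousOn
  -- transfer to `u` (uniqueness) and upgrade in `x` (continuity of the slice)
  have hu_ae : ∀ᵐ t ∂(volume.restrict (Ioo a T)), ∀ x, ‖u t x‖ ≤ M := by
    filter_upwards [hM', ae_restrict_mem measurableSet_Ioo] with t ht htmem
    have ht0 : 0 ≤ t := (ha.trans htmem.1).le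
    have hae : u t =ᵐ[volume] v t :=
      hK.ae_eq kato_unique_holds hν hv ht0 htmem.2 (by linarith [htmem.2])
    have hae' : ∀ᵐ x ∂((volume : Measure ℝ³).restrict univ),
        (fun x => ‖u t x‖) x ≤ (fun _ => M) x := by
      rw [Measure.restrict_univ]
      filter_upwards [hae, ht] with x hx hvx
      simp only [hx]
      exact hvx
    have hslice : ContinuousOn (fun x => ‖u t x‖) univ := by
      have hc : Continuous fun x : ℝ³ => uncurry u (t, x) :=
        hcont.comp_continuous (Continuous.prodMk_right t)
          (fun x => ⟨⟨ha.trans htmem.1, htmem.2⟩, mem_univ _⟩)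
      exact hc.norm.continuousOn
    exact fun x => SereginSverak2009.forall_le_of_ae_le_of_continuousOn isOpen_univ hslice
      continuousOn_const hae' x (mem_univ x)
  -- upgrade in `t` (continuity of time sections)
  intro t ht x
  have htime : ContinuousOn (fun s => ‖u s x‖) (Ioo a T) := by
    have hc : ContinuousOn (fun s : ℝ => uncurry u (s, x)) (Ioo a T) :=
      hcont.comp (Continuous.prodMk_left x).continuousOn
        (fun s hs => ⟨⟨ha.trans hs.1, hs.2⟩, mem_univ _⟩)
    exact hc.norm
  have hae : ∀ᵐ s ∂(volume.restrict (Ioo a T)), (fun s => ‖u s x‖) s ≤ (fun _ => M) s := by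
    filter_upwards [hu_ae] with s hs using hs x
  exact SereginSverak2009.forall_le_of_ae_le_of_continuousOn isOpen_Ioo htime continuousOn_const
    hae t ht

/-- **Converse, pointwise form: under the crux every point (axis or not) of such a Kato solution
is bounded near the top** (the backward cylinder of radius `√(T/2)` about `(T, x₀)`). -/
theorem isBoundedNearTop_of_crux (h : AxisymmetricKatoGlobal) {ν T : ℝ} (hν : 0 < ν) (hT : 0 < T)
    {u₀ : ℝ³ → ℝ³} {g : HomSobolev ℝ³ ℂ³ (1 / 2 : ℝ)} {u : ℝ → ℝ³ → ℝ³}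
    (hrep : g.Represents (Literature.Analysis.FunctionSpaces.EuclideanSpace.complexify ∘ u₀))
    (hax : IsAxisymmetric u₀) (hK : IsKatoSolutionOn T ν u₀ u)
    (hsm : ContDiffOn ℝ (⊤ : ℕ∞) (uncurry u) (Ioo 0 T ×ˢ univ)) (x₀ : ℝ³) :
    IsBoundedNearTop u T x₀ := by
  have ha : 0 < T / 2 := by positivity
  obtain ⟨M, hM⟩ := forall_norm_le_of_crux h hν hT hrep hax hK hsm ha
  have hsq : Real.sqrt (T / 2) ^ 2 = T / 2 := Real.sq_sqrt ha.le
  refine ⟨Real.sqrt (T / 2), Real.sqrt_pos.2 ha, M, fun t ht x _ => hM t ?_ x⟩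
  exact ⟨by linarith [ht.1, hsq], ht.2⟩

/-- **Converse: crux ⇒ E\***. -/
theorem katoAxisRegularTop_of_crux (h : AxisymmetricKatoGlobal) : KatoAxisRegularTop :=
  fun _ν hν _T hT _u₀ _g _u hrep hax hK hsm _ x₀ _ => isBoundedNearTop_of_crux h hν hT hrep hax hK hsm x₀

/-- **The crux is, over landed theorems, exactly final-time axis regularity of axisymmetric Kato
solutions.**  Consequently every "criterion + estimate" decomposition has its estimate piece
equivalent to the crux modulo the (printed) criterion. -/
theorem crux_iff_katoAxisRegularTop : AxisymmetricKatoGlobal ↔ KatoAxisRegularTop :=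
  ⟨katoAxisRegularTop_of_crux, crux_of_katoAxisRegularTop⟩

/-! ## §2b The live line's a-priori estimate is the crux (modulo the tree)

The registered stub `stub_swirlAxisModulus` of line `registered`, with the (harmless, available in
every use) extra hypothesis that the DATUM is axisymmetric.  Seregin's 2022 criterion being
DISCHARGED in the tree (`Literature.Analysis.FluidPDE.seregin2022_logSwirl_regularAtOrigin_holds`),
the estimate alone implies the crux; conversely the crux implies it (`forall_norm_le_of_crux` and
`|Γ| ≤ 2 r ‖u‖ ≤ 12 M / |log r|³`). -/

/-- The log³ axis modulus of the swirl up to the final time, for axisymmetric Kato solutions with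
axisymmetric represented data (= hypothesis 2 of `Registered.AxisymmetricKatoGlobal_of_logSwirlFacts`
plus `IsAxisymmetric u₀`). -/
def SwirlAxisModulusAx : Prop :=
  ∀ ν : ℝ, 0 < ν → ∀ T : ℝ, 0 < T → ∀ (u₀ : ℝ³ → ℝ³) (g : HomSobolev ℝ³ ℂ³ (1 / 2 : ℝ))
    (u : ℝ → ℝ³ → ℝ³),
    g.Represents (Literature.Analysis.FunctionSpaces.EuclideanSpace.complexify ∘ u₀) →
    IsAxisymmetric u₀ → IsKatoSolutionOn T ν u₀ u →
    ContDiffOn ℝ (⊤ : ℕ∞) (uncurry u) (Ioo 0 T ×ˢ univ) → (∀ t ∈ Ioo 0 T, IsAxisymmetric (u t)) →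
    ∀ t₀ ∈ Ioo 0 T, ∃ C δ₀ : ℝ, 0 < δ₀ ∧ δ₀ < 1 ∧
      ∀ t ∈ Ico t₀ T, ∀ x : ℝ³, cylRadius x ≤ δ₀ →
        |swirl (u t) x| ≤ C / |Real.log (cylRadius x)| ^ 3

/-- **Estimate ⇒ crux** (Seregin 2022 discharged; landed stubs 1, K, 2b', 2c'). -/
theorem crux_of_swirlAxisModulusAx (h3 : SwirlAxisModulusAx) : AxisymmetricKatoGlobal := by
  refine crux_of_katoAxisRegularTop ?_
  intro ν hν T hT u₀ g u hrep hax hK hsm haxi x₀ _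
  have ht₀ : T / 2 ∈ Ioo 0 T := ⟨by linarith, by linarith⟩
  obtain ⟨C, δ₀, hδ₀, hδ₁, hmod⟩ := h3 ν hν T hT u₀ g u hrep hax hK hsm haxi (T / 2) ht₀
  exact Registered.logSwirlRegularity_of_seregin2022
    Literature.Analysis.FluidPDE.seregin2022_logSwirl_regularAtOrigin_holds hν hT hK hsm haxi
    ⟨T / 2, ht₀, C, δ₀, hδ₀, hδ₁, hmod⟩ x₀

/-- **Crux ⇒ estimate**: under the crux the solution is bounded by some `M` on `(t₀/2, T) × ℝ³`,
and `|Γ| ≤ 2 r ‖u‖ ≤ 12 M / |log r|³` for `r ≤ e⁻¹` (`Registered.mul_abs_log_pow_three_le`). -/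
theorem swirlAxisModulusAx_of_crux (h : AxisymmetricKatoGlobal) : SwirlAxisModulusAx := by
  intro ν hν T hT u₀ g u hrep hax hK hsm _ t₀ ht₀
  have ha : 0 < t₀ / 2 := by linarith [ht₀.1]
  obtain ⟨M, hM⟩ := forall_norm_le_of_crux h hν hT hrep hax hK hsm ha
  have hM0 : 0 ≤ M := (norm_nonneg _).trans (hM t₀ ⟨by linarith [ht₀.1], ht₀.2⟩ 0)
  refine ⟨12 * M, Real.exp (-1), Real.exp_pos _, by
    rw [← Real.exp_zero]; exact Real.exp_lt_exp.2 (by norm_num), ?_⟩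
  intro t ht x hx
  rcases (cylRadius_nonneg x).eq_or_lt with hr0 | hrpos
  · -- on the axis both sides vanish (`log 0 = 0`, `C / 0 = 0`)
    rw [swirl_eq_zero_of_cylRadius_eq_zero (u t) hr0.symm, ← hr0]
    simp
  · have hr1 : cylRadius x < 1 := lt_of_le_of_lt hx (by
      rw [← Real.exp_zero]; exact Real.exp_lt_exp.2 (by norm_num))
    have hlogpos : 0 < |Real.log (cylRadius x)| := abs_pos.2 (Real.log_neg hrpos hr1).ne
    have hpow : 0 < |Real.log (cylRadius x)| ^ 3 := pow_pos hlogpos 3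
    have hux : ‖u t x‖ ≤ M := hM t ⟨by linarith [ht.1, ht₀.1], ht.2⟩ x
    have hkey := Registered.mul_abs_log_pow_three_le hrpos hr1
    rw [le_div_iff₀ hpow]
    calc |swirl (u t) x| * |Real.log (cylRadius x)| ^ 3
        ≤ (2 * cylRadius x * ‖u t x‖) * |Real.log (cylRadius x)| ^ 3 := by
          gcongr
          exact Registered.abs_swirl_le_two_mul_cylRadius_mul_norm (u t) x
      _ = 2 * ‖u t x‖ * (cylRadius x * |Real.log (cylRadius x)| ^ 3) := by ring
      _ ≤ 2 * M * 6 := by gcongr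
      _ = 12 * M := by ring

/-- **The live line's open stub is the crux, modulo the tree.** -/
theorem crux_iff_swirlAxisModulusAx : AxisymmetricKatoGlobal ↔ SwirlAxisModulusAx :=
  ⟨swirlAxisModulusAx_of_crux, crux_of_swirlAxisModulusAx⟩

/-! ## §3 The swirl-size split (Dec-D): typed, assembled, and why it gives no leverage -/

/-- **Small piece**: absolute small swirl, `|Γ₀| = |x₀u₁ − x₁u₀| ≤ ε ν` everywhere (scale-invariant:
`Γ` has the dimension of `ν`).  For fixed absolute `ε` this is the open problem recorded by
Lei–Ren 2022 after their Thm 3 ("beyond the reach of existing methods"); known only for `ε`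
depending on the other components of the datum (Lei–Zhang, Wei). -/
def AKGSmallSwirl (ε : ℝ) : Prop :=
  ∀ ν : ℝ, 0 < ν → ∀ (u₀ : ℝ³ → ℝ³) (g : HomSobolev ℝ³ ℂ³ (1 / 2 : ℝ)),
    MemLp u₀ 3 volume →
    g.Represents (Literature.Analysis.FunctionSpaces.EuclideanSpace.complexify ∘ u₀) →
    IsWeaklyDivFree u₀ → IsAxisymmetric u₀ → (∀ x, |swirl u₀ x| ≤ ε * ν) →
    HasGlobalKatoSolution ν u₀

/-- **Large piece**: the complementary data (swirl exceeding `ε ν` somewhere) — the crux on an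
open, scaling-invariant, generic set of data. -/
def AKGLargeSwirl (ε : ℝ) : Prop :=
  ∀ ν : ℝ, 0 < ν → ∀ (u₀ : ℝ³ → ℝ³) (g : HomSobolev ℝ³ ℂ³ (1 / 2 : ℝ)),
    MemLp u₀ 3 volume →
    g.Represents (Literature.Analysis.FunctionSpaces.EuclideanSpace.complexify ∘ u₀) →
    IsWeaklyDivFree u₀ → IsAxisymmetric u₀ → (∃ x, ε * ν < |swirl u₀ x|) →
    HasGlobalKatoSolution ν u₀

/-- Assembly of Dec-D (a case split). -/
theorem crux_of_swirlSplit {ε : ℝ} (hs : AKGSmallSwirl ε) (hl : AKGLargeSwirl ε) :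
    AxisymmetricKatoGlobal := by
  intro ν hν u₀ g hL3 hrep hdiv hax
  have hax' : IsAxisymmetric u₀ := fun θ x => hax θ x
  by_cases hsmall : ∀ x, |swirl u₀ x| ≤ ε * ν
  · exact hs ν hν u₀ g hL3 hrep hdiv hax' hsmall
  · push Not at hsmall
    exact hl ν hν u₀ g hL3 hrep hdiv hax' hsmall

/-- The small piece is a special case of the crux (so it is strictly on the way, not beside it). -/
theorem akgSmallSwirl_of_crux (h : AxisymmetricKatoGlobal) (ε : ℝ) : AKGSmallSwirl ε :=
  fun ν hν u₀ g hL3 hrep hdiv hax _ => h ν hν u₀ g hL3 hrep hdiv (fun θ x => hax θ x)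

/-- The large piece is a special case of the crux as well. -/
theorem akgLargeSwirl_of_crux (h : AxisymmetricKatoGlobal) (ε : ℝ) : AKGLargeSwirl ε :=
  fun ν hν u₀ g hL3 hrep hdiv hax _ => h ν hν u₀ g hL3 hrep hdiv (fun θ x => hax θ x)

/-- `ε = 0`: the small piece at `ε = 0` is the swirl-free stratum, a THEOREM (landed). -/
theorem akgSmallSwirl_zero : AKGSmallSwirl 0 := by
  intro ν hν u₀ g hL3 _ hdiv hax hsmall
  have hsw : HasNoSwirl u₀ := fun x => by
    have := hsmall x
    rw [zero_mul] at this
    exact abs_eq_zero.1 (le_antisymm this (abs_nonneg _))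
  exact NoSwirlStratum.hasGlobalKatoSolution_of_isAxisymmetric_hasNoSwirl_viscosity hν hL3 hdiv hax hsw

end Summit.NavierStokesRegularity.NavierStokesRegularity.Cruxes.AxisymmetricKatoGlobal.StrategistS20g7

end
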